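import Summits.QuantumFields.BalabanUV.Beta.D1BFx.GhostBubbleTailsII
import Summits.QuantumFields.BalabanUV.Beta.D1BFx.SplitInstanceS

/-!
# `BalabanUV.Beta.D1BFx.GhostBubbleTailsS` — road «BF-x» for binder row D1, ENDₛ row «L-GBUB-ii» DOCKED TO THE OWNER's TWO-PROFILE REST TABLE:
# the three graded KIN × KIN ghost-bubble clauses for `SplitInstanceS.restKS n a (gfrz n a b) (fun v => s n * gfrz n a b v)` (the (SPLIT)ₛ identity's
# rest words, `split_at_basePoint_recutS`) under the tie `hω_s` and the pin `s n = n⁻²` — by `restKS_gbub_eq` (rfl) from `GhostBubbleTailsII.hGbub_s_of_prop12`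

HONEST DEPENDENCY (page 1, mandatory): continuum YM on T⁴ ⇐ BetaPertH ∧ nine spine estimates (0/9 proved); BetaPertH ⇐ (D1) ∧ (D4) ∧
CAP+tail; G-an2-4 gates asym, D1 and NE2/3/4.  HONEST FRAMING (cell contract, verbatim): «discharging `BetaPertH` makes Bałaban's UV
stability UNCONDITIONAL — a real constructive-QFT result; it is NOT the continuum limit and NOT the Clay problem.»  THIS MODULE DISCHARGES
NOTHING of the wall: a [folklore] one-line re-spelling of `GhostBubbleTailsII.hGbub_s_of_prop12` (p288541) in the currency of the OWNER's ENDₛ file (a)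
`SplitInstanceS` (p288851: `restKS`, `restKS_gbub_eq`), so that the (b) chain twin's `hGbub` slot — which reads the ghost rest words through `restKS … g (fun v => s * g v)` —
is discharged BY NAME at the pin.  CONDITIONAL, as its parent, on [B5, Prop. 1.2] ∕ [B5, (1.126)–(1.127)] BY NAME (`h12`∕`h126`, rows of `gfrz` only).  No `def`,
no `Prop` minted, nothing cited, 0 sorry.  0 wall binders discharged; ENDₛ (b) NOT in tree; (K) NOT closed; NOT D1, NOT `BetaPertH`, NOT continuum, NOT Clay.

ABSOLUTE RULE (cell charter, verbatim): «No internally-minted statement may enter as a cited fact. Every hypothesis is either kernel-proved in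
this package or a verbatim quotation of a PUBLISHED theorem with page reference. The manuscript(s) under audit are NOT citable for their own
disputed steps — they are the thing under adjudication; programme-internal (2001/route/tribunal) claims are never citable.»

WHY (owner d1-p2 RULING ρ-g11-11 (3) «ENDₛ»; d1-p2-g12 FILE (a) `SplitInstanceS` p288851 ✓ — `split_at_basePoint_recutS … (s) (hωs : ωgh * (s * cK) ^ 2 = -2 * (ωgl * cE ^ 2)) … =
stK μ ν N g w + Σ_τ restKS n a g (fun v => s * g v) … τ w`; owner WORDS 15:46Z (1) «any other spelling → one word and I add the 5-line corollary» — pre-empted here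
with the landed spelling).
* [folklore] **`hGbub_S_of_prop12`**: `∃ C ≥ 0, ∀ n ≥ 2, |Σ_{b ∈ image resSite} n⁻⁴·fullSum (w ↦ restKS n a (gfrz n a b) (fun v => s n * gfrz n a b v) … (n⁸) N μ ν b (inr³(inl(0,0,r,r′))) w)| ≤ C`
  for `(r,r′) ≠ (0,0)`, under `hlam`, `hs : s n = n⁻²`, `hω_s`.
Unit `b2b-balaban-gan24-formalise-leaf-05` (gen 44); `LEAVES-BFx.md` row «L-GBUB-ii» (ENDₛ docking).
-/

noncomputable section

namespace Summit.QuantumFields.BalabanUV.Beta.D1BFx.GhostBubbleTailsS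

open Finset
open scoped BigOperators
open Literature.MathematicalPhysics.QuantumFieldTheory.Balaban1983to89
open Literature.MathematicalPhysics.QuantumFieldTheory.Balaban1983to89.Beta
open DyadicShell (Pt toReal)
open WindowIdentification (fullSum)
open DressedMomentNormalisation (resSite)
open Summit.QuantumFields.BalabanUV.Beta.D1BFx.ReducedKernel (TableR)
open Summit.QuantumFields.BalabanUV.Beta.D1BFx.SplitInstanceS (restKS restKS_gbub_eq)
open Summit.QuantumFields.BalabanUV.Beta.D1BFx.FrozenLegProfile (gfrz)
open Summit.QuantumFields.BalabanUV.Beta.D1BFx.FrozenLegTails (nOf MOf hn1)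
open Summit.QuantumFields.BalabanUV.Beta.D1BFx.GhostBubbleTailsII (hGbub_s_of_prop12)
open VectorTailsLoc (fam kfam)

variable {a : ℝ} {cE cΛ cR cK cQ cE₂ cJ4 cΛ₂ cR₂ cQ₂ x₀ ωgl ωgh : ℕ → ℝ} {WE WJ WΛ WR WQ : ℕ → TableR} {N : ℝ} {μ ν : Fin 4}

/-- [folklore] **«L-GBUB-ii» AT THE ENDₛ REST TABLE**: the three graded KIN × KIN ghost-bubble clauses for the OWNER's two-profile rest words
`restKS n a (gfrz n a b) (fun v => s n * gfrz n a b v) …` at `τ = inr³ (inl (0, 0, r, r'))`, `(r, r') ≠ (0, 0)`, under `hlam`, the pin `hs : s n = n⁻²` and the tie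
`hω_s : ωgh·(s·cK)² = −2·ωgl·cE²` — `restKS_gbub_eq` (rfl) + `GhostBubbleTailsII.hGbub_s_of_prop12`.  MODULO [B5, Prop. 1.2] ∕ [(1.126)–(1.127)] BY NAME. -/
theorem hGbub_S_of_prop12 (ha : 0 < a) (h12 : B5.Prop12Printed (fam nOf hn1 MOf a ha)) (h126 : B5.Kernel126_127Printed (kfam nOf MOf))
    (hlam : ∀ n : ℕ, 2 ≤ n → ωgl n * cE n ^ 2 = 2 * N ^ 2 * (n : ℝ) ^ 8) (s : ℕ → ℝ) (hs : ∀ n : ℕ, 2 ≤ n → s n = ((n : ℝ) ^ 2)⁻¹)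
    (hω_s : ∀ n : ℕ, 2 ≤ n → ωgh n * (s n * cK n) ^ 2 = -2 * (ωgl n * cE n ^ 2))
    (r r' : Fin 2) (hrr : ¬(r = 0 ∧ r' = 0)) :
    ∃ C : ℝ, 0 ≤ C ∧ ∀ n : ℕ, 2 ≤ n → ∀ [NeZero n],
      |∑ b ∈ (univ : Finset (Fin 4 → Fin n)).image resSite, ((n : ℝ) ^ 4)⁻¹ *
        fullSum (fun w : Pt => restKS n a (gfrz n a b) (fun v => s n * gfrz n a b v) (cE n) (cΛ n) (cR n) (cK n) (cQ n) (cE₂ n) (cJ4 n) (cΛ₂ n)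
          (cR₂ n) (cQ₂ n) (x₀ n) (WE n) (WJ n) (WΛ n) (WR n) (WQ n) (ωgl n) (ωgh n) ((n : ℝ) ^ 8) N μ ν b
            (Sum.inr (Sum.inr (Sum.inr (Sum.inl ((0 : Fin 2), (0 : Fin 2), r, r'))))) w)| ≤ C := by
  obtain ⟨C, hC, h⟩ := hGbub_s_of_prop12 (cΛ := cΛ) (cR := cR) (cQ := cQ) (cE₂ := cE₂) (cJ4 := cJ4) (cΛ₂ := cΛ₂) (cR₂ := cR₂) (cQ₂ := cQ₂) (x₀ := x₀)
    (WE := WE) (WJ := WJ) (WΛ := WΛ) (WR := WR) (WQ := WQ) (μ := μ) (ν := ν) ha h12 h126 hlam s hs hω_s r r' hrr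
  refine ⟨C, hC, fun n hn _ => ?_⟩
  simp only [restKS_gbub_eq]
  exact h n hn

/-! ## §2 (v1.1, APPENDED 2026-08-21 after the OWNER's `LocalGroupRowS` p291472) The END-shaped constant families: `∃ CG : Fin 2 → Fin 2 → ℝ, ∀ r r′ ≠ (0,0), …` -/

open Summit.QuantumFields.BalabanUV.Beta.D1BFx.SplitRecut (restK')

/-- [folklore] **THE `hGbub` BINDER OF `LocalGroupRowS.hLoc_of_prop12'S` (p291472), SUPPLIED**: one constant family `CG : Fin 2 → Fin 2 → ℝ` for the three local
ghost bubble words of `restK'` AT THE SECOND PROFILE `fun v => s n * gfrz n a b v`, under `hlam`, the pin `hs : s n = n⁻²` and the tie `hω_s` — `choose` over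
`GhostBubbleTailsII.hGbub_s_of_prop12`.  Feeds the owner's binder term-for-term (`obtain ⟨CG, hGbub⟩ := exists_CG_s_of_prop12 …`).  MODULO [B5, Prop. 1.2] ∕
[(1.126)–(1.127)] BY NAME. -/
theorem exists_CG_s_of_prop12 (ha : 0 < a) (h12 : B5.Prop12Printed (fam nOf hn1 MOf a ha)) (h126 : B5.Kernel126_127Printed (kfam nOf MOf))
    (hlam : ∀ n : ℕ, 2 ≤ n → ωgl n * cE n ^ 2 = 2 * N ^ 2 * (n : ℝ) ^ 8) (s : ℕ → ℝ) (hs : ∀ n : ℕ, 2 ≤ n → s n = ((n : ℝ) ^ 2)⁻¹)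
    (hω_s : ∀ n : ℕ, 2 ≤ n → ωgh n * (s n * cK n) ^ 2 = -2 * (ωgl n * cE n ^ 2)) :
    ∃ CG : Fin 2 → Fin 2 → ℝ, ∀ (r r' : Fin 2), ¬(r = 0 ∧ r' = 0) → ∀ n : ℕ, 2 ≤ n → ∀ [NeZero n],
      |∑ b ∈ (univ : Finset (Fin 4 → Fin n)).image resSite, ((n : ℝ) ^ 4)⁻¹ *
        fullSum (fun w : Pt => restK' n a (fun v => s n * gfrz n a b v) (cE n) (cΛ n) (cR n) (cK n) (cQ n) (cE₂ n) (cJ4 n) (cΛ₂ n) (cR₂ n) (cQ₂ n) (x₀ n)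
          (WE n) (WJ n) (WΛ n) (WR n) (WQ n) (ωgl n) (ωgh n) ((n : ℝ) ^ 8) N μ ν b
            (Sum.inr (Sum.inr (Sum.inr (Sum.inl ((0 : Fin 2), (0 : Fin 2), r, r'))))) w)| ≤ CG r r' := by
  classical
  have h := fun (r r' : Fin 2) (hrr : ¬(r = 0 ∧ r' = 0)) =>
    hGbub_s_of_prop12 (cΛ := cΛ) (cR := cR) (cQ := cQ) (cE₂ := cE₂) (cJ4 := cJ4) (cΛ₂ := cΛ₂) (cR₂ := cR₂) (cQ₂ := cQ₂) (x₀ := x₀)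
      (WE := WE) (WJ := WJ) (WΛ := WΛ) (WR := WR) (WQ := WQ) (μ := μ) (ν := ν) ha h12 h126 hlam s hs hω_s r r' hrr
  refine ⟨fun r r' => if hrr : ¬(r = 0 ∧ r' = 0) then Classical.choose (h r r' hrr) else 0, fun r r' hrr n hn _ => ?_⟩
  dsimp only
  rw [dif_pos hrr]
  exact (Classical.choose_spec (h r r' hrr)).2 n hn

/-- [folklore] … and the same family for the owner's two-profile table `restKS n a (gfrz n a b) (fun v => s n * gfrz n a b v)` (`restKS_gbub_eq`, rfl). -/
theorem exists_CG_S_of_prop12 (ha : 0 < a) (h12 : B5.Prop12Printed (fam nOf hn1 MOf a ha)) (h126 : B5.Kernel126_127Printed (kfam nOf MOf))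
    (hlam : ∀ n : ℕ, 2 ≤ n → ωgl n * cE n ^ 2 = 2 * N ^ 2 * (n : ℝ) ^ 8) (s : ℕ → ℝ) (hs : ∀ n : ℕ, 2 ≤ n → s n = ((n : ℝ) ^ 2)⁻¹)
    (hω_s : ∀ n : ℕ, 2 ≤ n → ωgh n * (s n * cK n) ^ 2 = -2 * (ωgl n * cE n ^ 2)) :
    ∃ CG : Fin 2 → Fin 2 → ℝ, ∀ (r r' : Fin 2), ¬(r = 0 ∧ r' = 0) → ∀ n : ℕ, 2 ≤ n → ∀ [NeZero n],
      |∑ b ∈ (univ : Finset (Fin 4 → Fin n)).image resSite, ((n : ℝ) ^ 4)⁻¹ *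
        fullSum (fun w : Pt => restKS n a (gfrz n a b) (fun v => s n * gfrz n a b v) (cE n) (cΛ n) (cR n) (cK n) (cQ n) (cE₂ n) (cJ4 n) (cΛ₂ n)
          (cR₂ n) (cQ₂ n) (x₀ n) (WE n) (WJ n) (WΛ n) (WR n) (WQ n) (ωgl n) (ωgh n) ((n : ℝ) ^ 8) N μ ν b
            (Sum.inr (Sum.inr (Sum.inr (Sum.inl ((0 : Fin 2), (0 : Fin 2), r, r'))))) w)| ≤ CG r r' := by
  obtain ⟨CG, h⟩ := exists_CG_s_of_prop12 (cΛ := cΛ) (cR := cR) (cQ := cQ) (cE₂ := cE₂) (cJ4 := cJ4) (cΛ₂ := cΛ₂) (cR₂ := cR₂) (cQ₂ := cQ₂) (x₀ := x₀)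
    (WE := WE) (WJ := WJ) (WΛ := WΛ) (WR := WR) (WQ := WQ) (μ := μ) (ν := ν) ha h12 h126 hlam s hs hω_s
  refine ⟨CG, fun r r' hrr n hn _ => ?_⟩
  simp only [restKS_gbub_eq]
  exact h r r' hrr n hn

end Summit.QuantumFields.BalabanUV.Beta.D1BFx.GhostBubbleTailsS

end
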